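import Literature.NumberTheory.ComplexMultiplication.MainTheoremCMLevelUniformization
import Literature.NumberTheory.ComplexMultiplication.MainTheoremCMLevelKappa
import Literature.NumberTheory.ComplexMultiplication.MainTheoremCMLevelTorsionTransport
import Literature.NumberTheory.ComplexMultiplication.MainTheoremCMLevelArithmetic
import Literature.NumberTheory.ComplexMultiplication.ShimuraTaniyamaPairReduction
import Literature.NumberTheory.ComplexMultiplication.CMTypeUniformizationBaseChange
import Literature.AlgebraicGeometry.Motives.AbelianVarietyGoodReductionConjugateTateGeom
import Literature.AlgebraicGeometry.Motives.AbelianVarietyGoodReductionConjugateGeomTorsion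
import Literature.AlgebraicGeometry.Motives.AbelianVarietyProjectiveChart
import Literature.AlgebraicGeometry.Motives.GoodReductionProofs
import Literature.NumberTheory.ComplexMultiplication.CMTypeGaloisClassReflexDegree
import Literature.NumberTheory.ComplexMultiplication.CMTypeUniformizationHoms
import Literature.NumberTheory.GaloisRepresentations.ChebotarevDegreeOnePrime
import Literature.NumberTheory.ComplexMultiplication.MainTheoremCMLevelPrime
import Literature.NumberTheory.ComplexMultiplication.MainTheoremCMLevelTypeNormBridge
import Literature.NumberTheory.ComplexMultiplication.MainTheoremCMLevelConjugateType
import Literature.NumberTheory.ComplexMultiplication.MainTheoremCMLevelPairTransport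
import Literature.NumberTheory.ComplexMultiplication.MainTheoremCMLevelCommonField
import Literature.NumberTheory.ComplexMultiplication.MainTheoremCMLevelArtinFrobenius
import Literature.NumberTheory.ComplexMultiplication.MainTheoremCMLevelUniformizationTransport
import Literature.NumberTheory.ComplexMultiplication.MainTheoremCMLevelKappaPoints
import Literature.AlgebraicGeometry.ComplexMultiplication.CMTypeRealisationIsogenyTransport
import Literature.NumberTheory.GaloisRepresentations.HeckeCharacter
import Literature.AlgebraicGeometry.Motives.AbelianVarietyGoodReductionConjugateRationalTorsion
import Literature.NumberTheory.ComplexMultiplication.MainTheoremCMLevelKappaOfPair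
import Literature.NumberTheory.ComplexMultiplication.MainTheoremCMLevelKappaOfPairDegOne
import Literature.NumberTheory.ComplexMultiplication.MainTheoremCMLevelPairOfModel
import Literature.NumberTheory.ComplexMultiplication.MainTheoremCMLevelQMultiplication
import HarnessLib

/-!
# The main theorem of complex multiplication — the level-`N` structure over a level field (Shimura 1998, §18.6, proof of Thm. 18.6, pp. 127–129)

Topic `Literature/NumberTheory/ComplexMultiplication`, namespace `Literature.NumberTheory.ComplexMultiplication`.
THEOREMS ONLY (no definition, no named fact; net Literature debt **0**).  Cell `hodgecm-mathlib` (D-0151), fan B-II, line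
`b2-main-theorem-cm` (crux `stmt-HodgeConjecture-24834`), stub **S7a `StubComposition` → `levelStructure`** (junction
`MainTheoremCMLevelUniformization.lean`): this file proves the per-level CORE `exists_isLevelUniformization_of_levelField` — for
one level `N`, with the level field `L₁` and the class-representative models already chosen, the existence of `ξ′, q, β` with
`IsLevelUniformization … N ξ′ q β ν`, `ν = N((s_𝐡))`.  The field selection (`L₁` from W(ii), the `N`-torsion field, the common
field of definition of the homomorphisms and the ray class field `C_N`) and the final `levelStructure_of_facts` are the companion
file `MainTheoremCMLevelStructure.lean`.  EDITION E1 (director g3 BATCH 79 (ii), B-plan1 `EDITIONS-h21-fanB.md` §E1): the core is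
proved from the DEGREE-ONE pair fact `shimuraTaniyamaPair_degOne` (`exists_isLevelUniformization_of_levelField_degOne`; the
Frobenius prime is chosen of absolute degree one, so nothing else changes) and the `shimuraTaniyamaPair`-edition is its one-line
corollary through `shimuraTaniyamaPair_degOne_of`.  HC_CM is proved only modulo the 7 printed citations until rung 0 closes;
nothing here changes that.

## References

* [Shimura1998] G. Shimura, *Abelian Varieties with Complex Multiplication and Modular Functions*, Princeton Univ. Press
  1998: §18.6, proof of Thm. 18.6, pp. 125–129 (the passage used, pp. 127–129, = held chunks p0166–p0169); §13.1 Thm. 1 (i) (p. 97);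
  §11.1 Prop. 12 (p. 83), Prop. 14 (i) (p. 85); §8.3 Prop. 28 (p. 62); §7.4 Prop. 15–17 (pp. 53–54). Pages per lit/PAGE-DELTAS-Shimura1998.md.
* [BombieriGubler2006] E. Bombieri, W. Gubler, *Heights in Diophantine Geometry*, Cambridge 2006, 10.3.9 (Néron model).
* [SerreTate1968] J.-P. Serre, J. Tate, *Good reduction of abelian varieties*, Ann. of Math. 88 (1968), §1 Thm. 1.
-/

set_option autoImplicit false

noncomputable section

open CategoryTheory CategoryTheory.Limits AlgebraicGeometry NumberField IsDedekindDomain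
open scoped NumberField nonZeroDivisors
open Literature.AlgebraicGeometry.Motives Literature.AlgebraicGeometry.Motives.AbelianVariety
open Literature.AlgebraicGeometry.Motives.AbelianVariety.GoodReductionAt
open Literature.AlgebraicGeometry.ComplexMultiplication
open Literature.AlgebraicGeometry.Motives.HodgeStructure (cmTypeSmul)
open Literature.NumberTheory.NumberFields
open Literature.NumberTheory.GaloisRepresentations (ideleGroup localUnits galFrob principalIdele HeckeCharacter)
open FractionalIdeal (spanSingleton)
open Literature.NumberTheory.Automorphic.FiniteAdeleRing (toFractionalIdeal)

namespace Literature.NumberTheory.ComplexMultiplication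

-- one declaration assembling ≈ 20 tree theorems over scheme-valued structures: the cumulative elaboration budget of the
-- proof exceeds the default (measured ≈ 3× on the farm); no single step is a brute-force search.
set_option maxHeartbeats 800000 in
/-- **Shimura 1998, proof of Thm. 18.6, pp. 127–129, for ONE level `N` over a chosen level field `L₁`:
the level-`N` uniformisation `ξ′` of `((A₀ ⊗ ℂ)^σ, (ι₀ ⊗ ℂ)^σ)` with (2)_N and the relative polarisation clause**
(`IsLevelUniformization`, junction of the S7 split of row II-1).  Hypotheses: the junction's binders; the LEVEL FIELD `L₁ ⊇ L`
(an abstract number field inside `ℂ`, Galois over `K* = traceField Φ`, with `σ|_{L₁} = γ`, `C_N ↪ L₁` via `j`); number-field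
models `A_c` over `L₁` of every ideal class `c` of `K` with uniformisations `η_c` (§18.6 p. 126 «(A_i, ι_i) of type
(K, Φ, 𝔞_i)», W(ii)); `L₁`-rationality of the `N`-torsion of `A₀ ⊗ ℂ` (p. 127 (iii)) and of the homomorphisms among the
family and its `γ`-conjugate (p. 127 (iv)); and the three reduction-theoretic NAMED FACTS of the line as hypotheses —
the Shimura–Taniyama pair fact AT ABSOLUTE DEGREE ONE `shimuraTaniyamaPair_degOne` (§13.1 Thm. 1 (i) at `N𝔭 = p`, the only
instance the proof consumes: the Frobenius prime is chosen of absolute degree one, `p 1 hcard`; edition E1 — the landed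
`shimuraTaniyamaPair`-edition `exists_isLevelUniformization_of_levelField` follows in one line below), the produced-data reduction binder `FactRH′` of the b2 workfile (cofinite Néron data
of a finite family with reduction of homomorphisms, incl. to/from the Frobenius conjugate; [BombieriGubler2006] 10.3.9,
§11.1 Prop. 12) and `exists_isTateCompatible_family_conjFrob` (§11.1 Prop. 14 (i), §18.6 p. 128 «(t^σ)~ = π(t̃)»).
Proof = the printed proof, every step a tree theorem: the prime `𝔓` of degree one with `σ = [𝔓, L₁/K*]` (p. 127 (1)–(4),
`exists_frobeniusPrime`), `[s, K*]|_{C_N} = Frob_𝔭` (`exists_abRestrict_ideleArtinMap_eq_galFrob_of_isArtinLift`), the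
idèle `c = s·(d₀)·e` and its torsion congruence / lattice / norm identities (pp. 128–129 (∗∗),
`exists_reflexNorm_torsionCongruence_of_abRestrict_ideleArtinMap_eq_galFrob`, `levelArithmetic_of_latticeIdentity`), `𝔮 = g(𝔭)`
(`exists_reflexTypeNorm_bridge_traceField`), the `𝔮`-multiplication `λ`, the Shimura–Taniyama isomorphism and
`θ : (A_i, ι_i) ≅ (A^σ, ι^σ)` with `κ̃ = π` (pp. 127–128, `exists_hom_iso_redHom_comp_eq_relFrobenius_of_pair_degOne`), «`t^σ = κt` on
`A[N]`» (p. 128, `map_eq_conjPoints_of_forall_prime`, `conjPoints_eq_map_of_forall_torsion`), the reindex `ξ′ = ξ₂ ∘ S(g(d₀))`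
(p. 128, `exists_reindex_forall_conj_eq_of_torsionCongruence_units`) and the polarisation clause (pp. 128–129,
`weilPairingLevel_conjugate_reindex_eq_pow_of_model`).  `ν = N((s_𝐡))` is level-independent.  Cell hodgecm-mathlib, line
b2-main-theorem-cm, stub S7a; assembled by the S7a crew (B-p06/09/10/12/16/19/20, A-p01/04).
[cite: Shimura1998, §18.6 proof of Thm. 18.6, pp. 125–129 (esp. pp. 127–128); §13.1 Thm. 1 (i) (p. 97); §11.1 Prop. 12 (p. 83) and Prop. 14 (i) (p. 85)]
[cite: BombieriGubler2006, 10.3.9 (p. 334)] -/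
theorem exists_isLevelUniformization_of_levelField_degOne
    {K : Type} [Field K] [NumberField K] [IsCMField K] (Φ : CMType K) [NumberField (traceField Φ)]
    (𝔞 𝔟 : (FractionalIdeal (𝓞 K)⁰ K)ˣ)
    {L : Type} [Field L] [NumberField L] [Algebra L ℂ] (A₀ : AbelianVariety L) (ι₀ : 𝓞 K →+* End A₀)
    (hA₀ : IsCMTypeRealisationOver Φ A₀ ι₀)
    (X : CartierDivisor A₀.X.left)
    (πA : (A₀.baseChange ℂ).X.left ⟶ A₀.X.left) (hπA : πA = pullback.fst A₀.X.hom (bcSpec L ℂ)) [IsDominant πA]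
    (ξ : CMTypeUniformization Φ 𝔞 (A₀.baseChange ℂ) ((endBaseChange ℂ A₀).comp ι₀))
    (σ : ℂ ≃ₐ[traceField Φ] ℂ) (s : ideleGroup (traceField Φ)) (hs : IsArtinLift (traceField Φ) s σ)
    (h𝔟 : 𝔟 = ideleMulIdealUnits (reflexNormFinitePart K Φ (traceField Φ) s)⁻¹ 𝔞)
    (πσ : ((A₀.baseChange ℂ).conjugate σ.toRingEquiv).X.left ⟶ (A₀.baseChange ℂ).X.left)
    (hπσ : πσ = baseChangeHomFst σ.toRingEquiv.toRingHom (A₀.baseChange ℂ).X) [IsDominant πσ]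
    (ℓ : ℕ) [Fact ℓ.Prime]
    [hdomA : ∀ k : ℕ, IsDominant (Hom.toSchemeHom (((ℓ ^ k : ℕ) : ℤ) • 𝟙 (A₀.baseChange ℂ)))]
    [hdomσ : ∀ k : ℕ,
      IsDominant (Hom.toSchemeHom (((ℓ ^ k : ℕ) : ℤ) • 𝟙 ((A₀.baseChange ℂ).conjugate σ.toRingEquiv)))]
    (N : ℕ) (hN : 0 < N) (hℓN : ℓ ∣ N)
    -- level field `L₁ ⊇ L · K* · C_N`, Galois over `K*`, `σ(L₁) = L₁` with `σ|_{L₁} = γ`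
    {L₁ : Type} [Field L₁] [NumberField L₁] [Algebra L L₁] [Algebra L₁ ℂ] [IsScalarTower L L₁ ℂ]
    [Algebra (traceField Φ) L₁] [IsScalarTower (traceField Φ) L₁ ℂ] [IsGalois (traceField Φ) L₁]
    (γ : L₁ ≃ₐ[traceField Φ] L₁) (hσγ : ∀ x : L₁, σ (algebraMap L₁ ℂ x) = algebraMap L₁ ℂ (γ x))
    (j : rayClassField (traceField Φ) (Ideal.span {((N : ℕ) : 𝓞 (traceField Φ))}) →ₐ[traceField Φ] L₁)
    -- class representatives over `L₁` (W(ii) + G0 tower)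
    (Arep : ClassGroup (𝓞 K) → AbelianVariety L₁) (ιrep : ∀ c, 𝓞 K →+* End (Arep c))
    (𝔞rep : ClassGroup (𝓞 K) → (FractionalIdeal (𝓞 K)⁰ K)ˣ) (h𝔞rep : ∀ c, ClassGroup.mk K (𝔞rep c) = c)
    (ηrep : ∀ c, CMTypeUniformization Φ (𝔞rep c) ((Arep c).baseChange ℂ) ((endBaseChange ℂ (Arep c)).comp (ιrep c)))
    -- rationality over `L₁`: `N`-torsion of `A₀ ⊗ ℂ` (G2) and homomorphisms (G1)
    (htors : ∀ Q ∈ (A₀.baseChange ℂ).torsionPoints ℂ (N : ℤ),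
      ∃ x ∈ (A₀.baseChange L₁).torsionPoints L₁ (N : ℤ),
        AlgPoints.map (baseChangeTowerIso L L₁ ℂ A₀).hom.hom.hom.hom
          ((A₀.baseChange L₁).pointsMulEquiv ℂ (AlgPoints.extendScalars (A₀.baseChange L₁).X L₁ ℂ x)) = Q)
    (hrat : ∀ c, Function.Surjective (Hom.baseChange ℂ :
      (A₀.baseChange L₁ ⟶ Arep c) → ((A₀.baseChange L₁).baseChange ℂ ⟶ (Arep c).baseChange ℂ)))
    (hrat' : ∀ c, Function.Surjective (Hom.baseChange ℂ :
      (Arep c ⟶ A₀.baseChange L₁) → ((Arep c).baseChange ℂ ⟶ (A₀.baseChange L₁).baseChange ℂ)))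
    (hratγ : ∀ c, Function.Surjective (Hom.baseChange ℂ :
      (Arep c ⟶ (A₀.baseChange L₁).conjugate γ.toRingEquiv) →
        ((Arep c).baseChange ℂ ⟶ ((A₀.baseChange L₁).conjugate γ.toRingEquiv).baseChange ℂ)))
    (hratγ' : ∀ c, Function.Surjective (Hom.baseChange ℂ :
      ((A₀.baseChange L₁).conjugate γ.toRingEquiv ⟶ Arep c) →
        (((A₀.baseChange L₁).conjugate γ.toRingEquiv).baseChange ℂ ⟶ (Arep c).baseChange ℂ)))
    -- the named facts: the Shimura–Taniyama pair fact AT ABSOLUTE DEGREE ONE (E1, `shimuraTaniyamaPair_degOne`), then `FactRH′`, (F-S5c)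
    (hS2 : shimuraTaniyamaPair_degOne)
    (hRH : ∀ {k : Type} [Field k] [NumberField k] {ι : Type} [Finite ι] (A : ι → AbelianVariety k),
      ∃ S : Set (HeightOneSpectrum (𝓞 k)), S.Finite ∧ ∀ v ∉ S, ∃ R : ∀ i, (A i).GoodReductionAt v,
        (∀ i j, Nonempty (GoodReductionAt.HomReduction (R i) (R j))) ∧
        ∀ {F₀ : Type} [Field F₀] [NumberField F₀] [Algebra F₀ k] (a : ι) (γ : k ≃ₐ[F₀] k)
          (hγ : IsArithFrobAt (𝓞 F₀) γ v.asIdeal) (p n : ℕ) [ExpChar v.asIdeal.ResidueField p]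
          (hq : Nat.card (𝓞 F₀ ⧸ v.asIdeal.under (𝓞 F₀)) = p ^ n),
          (∀ i, Nonempty (GoodReductionAt.HomReduction (R i) ((R a).conjFrob γ hγ p n hq))) ∧
          (∀ i, Nonempty (GoodReductionAt.HomReduction ((R a).conjFrob γ hγ p n hq) (R i))))
    (hS5c : ∀ {F₀ k : Type} [Field F₀] [NumberField F₀] [Field k] [NumberField k] [Algebra F₀ k]
      {v : HeightOneSpectrum (𝓞 k)} {ι : Type} {A : ι → AbelianVariety k}
      (R : ∀ i, (A i).GoodReductionAt v) (H : ∀ i j, GoodReductionAt.HomReduction (R i) (R j)) (a : ι)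
      (γ : k ≃ₐ[F₀] k) (hγ : IsArithFrobAt (𝓞 F₀) γ v.asIdeal) (p n : ℕ) [ExpChar v.asIdeal.ResidueField p]
      (hq : Nat.card (𝓞 F₀ ⧸ v.asIdeal.under (𝓞 F₀)) = p ^ n)
      (Hγ : ∀ i, GoodReductionAt.HomReduction (R i) ((R a).conjFrob γ hγ p n hq))
      (Hγ' : ∀ i, GoodReductionAt.HomReduction ((R a).conjFrob γ hγ p n hq) (R i)) (ℓ : ℕ) [Fact ℓ.Prime],
      GoodReductionAt.HomReduction.exists_isTateCompatible_family_conjFrob R H a γ hγ p n hq Hγ Hγ' ℓ) :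
    ∃ (ξ' : CMTypeUniformization Φ 𝔟 ((A₀.baseChange ℂ).conjugate σ.toRingEquiv)
        (((A₀.baseChange ℂ).endConjugate σ.toRingEquiv).comp ((endBaseChange ℂ A₀).comp ι₀))) (q : ℕ) (β : K),
      IsLevelUniformization Φ 𝔞 𝔟 A₀ ι₀ X πA ξ σ s πσ ℓ N ξ' q β
        ((FractionalIdeal.absNorm (toFractionalIdeal (𝓞 (traceField Φ)) (traceField Φ)
          (IdeleAction.finitePart (traceField Φ) s)) : ℚ) : K) := by
  classical
  have hN0 : N ≠ 0 := Nat.pos_iff_ne_zero.mp hN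
  subst h𝔟
  -- §0  `σΦ = Φ` (Prop. 28; G9)
  have hΦ : cmTypeSmul σ.toRingEquiv Φ = Φ := cmTypeSmul_algEquiv_traceField Φ σ
  -- §1  the finite family over `L₁` (`none ↦ A₀ ⊗ L₁`, `some c ↦ Arep c`): its cofinite PRODUCED reduction data
  --     (binder `FactRH'` of b2-main v2m = B-p07 cofinite Néron data + F-HR companions; one `S` for the family)
  let Fam : Option (ClassGroup (𝓞 K)) → AbelianVariety L₁ := fun o => o.elim (A₀.baseChange L₁) Arep
  obtain ⟨S, hSfin, hSdata⟩ := hRH Fam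
  -- §2  G5: the Frobenius prime `v` of `L₁` (degree one over `ℚ`, unramified, `v ∉ S`, `v ∤ N`, `γ = Frob_v`)
  obtain ⟨v, p, hvS, hp, hpN, hpv, hNv, hchar, hγv, hcard, hunr, huniq⟩ := exists_frobeniusPrime γ hSfin hN0
  haveI := hchar
  haveI : Fact p.Prime := ⟨hp⟩
  --     the data at `v`, chosen ONCE: `Rfam`, `Hfam`, the conjFrob companions at `a := none`, and F-S5c for EVERY `ℓ′`
  obtain ⟨Rfam, hHfam, hHγfam⟩ := hSdata v hvS
  obtain ⟨hHγ1, hHγ2⟩ := hHγfam (F₀ := traceField Φ) none γ hγv p 1 hcard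
  let Hfam : ∀ i j, HomReduction (Rfam i) (Rfam j) := fun i j => Classical.choice (hHfam i j)
  let Hγfam : ∀ i, HomReduction (Rfam i) ((Rfam none).conjFrob γ hγv p 1 hcard) := fun i => Classical.choice (hHγ1 i)
  let Hγ'fam : ∀ i, HomReduction ((Rfam none).conjFrob γ hγv p 1 hcard) (Rfam i) := fun i => Classical.choice (hHγ2 i)
  have hdata : ∀ (ℓ' : ℕ) [Fact ℓ'.Prime],
      HomReduction.exists_isTateCompatible_family_conjFrob Rfam Hfam none γ hγv p 1 hcard Hγfam Hγ'fam ℓ' :=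
    fun ℓ' _ => hS5c Rfam Hfam none γ hγv p 1 hcard Hγfam Hγ'fam ℓ'
  let R : (A₀.baseChange L₁).GoodReductionAt v := Rfam none
  have hℓv : ((ℓ : ℕ) : 𝓞 L₁) ∉ v.asIdeal := fun h => hNv (by
    obtain ⟨m, rfl⟩ := hℓN
    rw [Nat.cast_mul]; exact v.asIdeal.mul_mem_right _ h)
  -- §3  G4: `𝔭 := v ∩ K*`, `𝔭 ∤ N`, `[s, K*]|_{C_N} = Frob_𝔭` (B-p06); `N𝔭 = p`; the uniformiser `ϖ`
  obtain ⟨𝔭, h𝔭v, h𝔭N, hsF⟩ :=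
    exists_abRestrict_ideleArtinMap_eq_galFrob_of_isArtinLift (traceField Φ) hN0 hs γ hσγ j hNv hγv
  have hq𝔭 : Ideal.absNorm 𝔭.asIdeal = p ^ 1 := by
    rw [Ideal.absNorm_apply, Submodule.cardQuot_apply, h𝔭v]; exact hcard
  have hϖ := HeckeCharacter.valued_uniformizer (K := traceField Φ) 𝔭
  -- §5  TT-idèle: `d₀`, torsion congruence (clause 2), lattice identity (clause 3), norm identity (clause 4),
  --     and the five arithmetic conjuncts for the lattice `𝔞` (B-p19)
  obtain ⟨d₀, -, hcong, hlat, hnorm⟩ :=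
    exists_reflexNorm_torsionCongruence_of_abRestrict_ideleArtinMap_eq_galFrob K Φ (traceField Φ) hN0 h𝔭N hϖ hsF
  obtain ⟨hβ0, hq0, hν, h𝔞β𝔟, ht⟩ :=
    levelArithmetic_of_latticeIdentity K Φ (traceField Φ) le_rfl hN0 hℓN h𝔭N hϖ (hlat 𝔞) hnorm
  -- §6  G6: `𝔮 = g(𝔭) = il(g(c₀)_𝐡)`, `𝔟ᵢ := g(c₀)_𝐡⁻¹𝔞 = 𝔮⁻¹𝔞`, `𝔮𝔟ᵢ = 𝔞` (B-p19)
  obtain ⟨𝔮, 𝔟ᵢ, h𝔮w, h𝔮𝔟ᵢ, h𝔮0, hil𝔮, h𝔟ᵢ_def, h𝔮count⟩ :=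
    exists_reflexTypeNorm_bridge_traceField (K := K) (Φ := Φ) 𝔭 hϖ 𝔞
  --     the lattice identity in the form G11a consumes: `g(s)_𝐡⁻¹𝔞 = g(d₀)·𝔟ᵢ` (from clause 3 + `h𝔟ᵢ_def`)
  have h𝔠 : IdeleAction.ideleMulIdeal (reflexNormFiniteIdele K Φ (traceField Φ)
        (IdeleAction.finitePart (traceField Φ) s))⁻¹ (𝔞 : FractionalIdeal (𝓞 K)⁰ K) =
      spanSingleton (𝓞 K)⁰ (reflexNormFrom K Φ (traceField Φ) d₀ * (1 : K)⁻¹) * (𝔟ᵢ : FractionalIdeal (𝓞 K)⁰ K) := by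
    have hg0 : reflexNormFrom K Φ (traceField Φ) d₀ ≠ 0 := fun h => hβ0 (by rw [h, inv_zero])
    have hcoe : (𝔟ᵢ : FractionalIdeal (𝓞 K)⁰ K) = IdeleAction.ideleMulIdeal (reflexNormFiniteIdele K Φ (traceField Φ)
        (IdeleAction.finitePart (traceField Φ) (localUnits 𝔭 (HeckeCharacter.uniformizer (traceField Φ) 𝔭))))⁻¹
          (𝔞 : FractionalIdeal (𝓞 K)⁰ K) := by
      rw [h𝔟ᵢ_def]; rfl
    rw [inv_one, mul_one, hcoe, hlat 𝔞, ← mul_assoc, FractionalIdeal.spanSingleton_mul_spanSingleton,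
      mul_inv_cancel₀ hg0, FractionalIdeal.spanSingleton_one, one_mul]
  -- §7  the class representative `A_c`, `c = [𝔟ᵢ]`, re-uniformised to type EXACTLY `𝔟ᵢ`
  set c : ClassGroup (𝓞 K) := ClassGroup.mk K 𝔟ᵢ with hc_def
  obtain ⟨bᵢ, η, hbᵢ, -, -, -⟩ := (ηrep c).exists_reindex_of_classGroup_mk_eq (𝔟 := 𝔟ᵢ) (by rw [h𝔞rep c])
  let Rᵢ : (Arep c).GoodReductionAt v := Rfam (some c)
  let H0i : HomReduction R Rᵢ := Hfam none (some c)
  let Hiγ : HomReduction Rᵢ (R.conjFrob γ hγv p 1 hcard) := Hγfam (some c)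
  let Hγi : HomReduction (R.conjFrob γ hγv p 1 hcard) Rᵢ := Hγ'fam (some c)
  let H0γ : HomReduction R (R.conjFrob γ hγv p 1 hcard) := Hγfam none
  -- §8  `ξ₁ = T⁻¹ ∘ ξ` on the model `(A₀ ⊗ L₁) ⊗ ℂ` (B-p20); the model is of type `(K, Φ)`
  obtain ⟨ξ₁, hξ₁⟩ := ξ.exists_tower_source (L₁ := L₁)
  have hA : IsCMTypeRealisationOver Φ (A₀.baseChange L₁) ((endBaseChange L₁ A₀).comp ι₀) := hA₀.baseChange
  -- §9  the `ℓ`-adic block at `v` (F-S5c at `ℓ`, same `Rfam`/`Hfam`)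
  obtain ⟨Tfam, Tγ, σℓ, hσℓa, hσℓb, hTTfam, hTTγ, hHT, hHγT, hHγ'T, h2'⟩ := hdata ℓ hℓv
  let T0 : R.TateSpecialisation ℓ := Tfam none
  let Ti : Rᵢ.TateSpecialisation ℓ := Tfam (some c)
  have h0i : H0i.IsTateCompatible T0 Ti := hHT none (some c)
  have hiγT : Hiγ.IsTateCompatible Ti Tγ := hHγT (some c)
  have hγiT : Hγi.IsTateCompatible Tγ Ti := hHγ'T (some c)
  have h0γ : H0γ.IsTateCompatible T0 Tγ := hHγT none
  -- §10–§12  the `𝔮`-multiplication `λ`, the Shimura–Taniyama `ψ` (F-S2) and `θ : A_c ≅ (A₀⊗L₁)^γ` with `κ̃ = π` (G10)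
  --     (B-p12 `exists_hom_iso_redHom_comp_eq_relFrobenius_of_pair_degOne`: G7 λ + F-S2₁ ψ + S3/G10 θ)
  obtain ⟨lam, θ, hlamι, hlam, hθι, hκ⟩ :
      ∃ (lam : A₀.baseChange L₁ ⟶ Arep c) (θ : Arep c ≅ (A₀.baseChange L₁).conjugate γ.toRingEquiv),
        (∀ a : 𝓞 K, (((endBaseChange L₁ A₀).comp ι₀) a : A₀.baseChange L₁ ⟶ A₀.baseChange L₁) ≫ lam =
          lam ≫ (ιrep c a : Arep c ⟶ Arep c)) ∧
        (∀ u : K, AlgPoints.map (Hom.baseChange ℂ lam).hom.hom.hom (ξ₁.r u) = η.r u) ∧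
        (∀ a : 𝓞 K, (ιrep c a : Arep c ⟶ Arep c) ≫ θ.hom =
          θ.hom ≫ ((((A₀.baseChange L₁).endConjugate γ.toRingEquiv).comp ((endBaseChange L₁ A₀).comp ι₀)) a :
            (A₀.baseChange L₁).conjugate γ.toRingEquiv ⟶ _)) ∧
        H0γ.redHom (lam ≫ θ.hom) = R.reduction.relFrobenius p 1 :=
    exists_hom_iso_redHom_comp_eq_relFrobenius_of_pair_degOne Φ 𝔞 𝔟ᵢ 𝔮 (A₀.baseChange L₁) (Arep c)
      ((endBaseChange L₁ A₀).comp ι₀) (ιrep c) hS2 h𝔮𝔟ᵢ hA ξ₁ η (hrat c) σ γ hσγ (hratγ c)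
      (hratγ' c) v 𝔭 h𝔭v hγv p hcard h𝔮w R Rᵢ H0i Hiγ Hγi H0γ hℓv T0 Ti Tγ h0i hiγT hγiT h0γ
  set κ : A₀.baseChange L₁ ⟶ (A₀.baseChange L₁).conjugate γ.toRingEquiv := lam ≫ θ.hom with hκ_def
  -- §13  `ξs := θ_ℂ ∘ η` on `((A₀⊗L₁)^γ) ⊗ ℂ`, type `𝔟ᵢ`, with `ξs = κ_ℂ ∘ ξ₁` on `r`; `ξ₂ := E ∘ ξs` on the junction carrier
  obtain ⟨ξs, hξs⟩ : ∃ ξs : CMTypeUniformization Φ 𝔟ᵢ (((A₀.baseChange L₁).conjugate γ.toRingEquiv).baseChange ℂ)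
      ((endBaseChange ℂ ((A₀.baseChange L₁).conjugate γ.toRingEquiv)).comp
        (((A₀.baseChange L₁).endConjugate γ.toRingEquiv).comp ((endBaseChange L₁ A₀).comp ι₀))),
      ∀ u : K, ξs.r u = AlgPoints.map (Hom.baseChange ℂ κ).hom.hom.hom (ξ₁.r u) := by
    -- `θ ⊗ ℂ` as an isomorphism of the complexifications, `𝓞_K`-equivariant by `hθι`
    let eθ : (Arep c).baseChange ℂ ≅ ((A₀.baseChange L₁).conjugate γ.toRingEquiv).baseChange ℂ :=
      { hom := Hom.baseChange ℂ θ.hom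
        inv := Hom.baseChange ℂ θ.inv
        hom_inv_id := by rw [← Hom.baseChange_comp, θ.hom_inv_id, Hom.baseChange_id]
        inv_hom_id := by rw [← Hom.baseChange_comp, θ.inv_hom_id, Hom.baseChange_id] }
    have heθ : ∀ a : 𝓞 K, ((endBaseChange ℂ (Arep c)).comp (ιrep c)) a ≫ eθ.hom =
        eθ.hom ≫ ((endBaseChange ℂ ((A₀.baseChange L₁).conjugate γ.toRingEquiv)).comp
          (((A₀.baseChange L₁).endConjugate γ.toRingEquiv).comp ((endBaseChange L₁ A₀).comp ι₀))) a := by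
      intro a
      change Hom.baseChange ℂ (ιrep c a : Arep c ⟶ Arep c) ≫ Hom.baseChange ℂ θ.hom =
        Hom.baseChange ℂ θ.hom ≫ Hom.baseChange ℂ
          ((((A₀.baseChange L₁).endConjugate γ.toRingEquiv).comp ((endBaseChange L₁ A₀).comp ι₀)) a :
            (A₀.baseChange L₁).conjugate γ.toRingEquiv ⟶ _)
      rw [← Hom.baseChange_comp, ← Hom.baseChange_comp, hθι a]
    refine ⟨η.ofIso eθ heθ, fun u => ?_⟩
    rw [CMTypeUniformization.ofIso_r, ← hlam u, hκ_def, Hom.baseChange_comp, AbelianVariety.map_hom_comp]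
  obtain ⟨ξ₂, hξ₂⟩ := ξs.exists_conjugate_tower_target (L := L) A₀ ι₀ γ.toRingEquiv σ.toRingEquiv hσγ
  -- §14  (2)_N: «κ = γ on (A₀⊗L₁)(L₁)[N]» (B-p09 per prime power ∘ B-p19 assembly, fed by `hdata` at each ℓ′ ∣ N),
  --      read in ℂ (B-p09 `conjPoints_eq_map_comp_of_forall_torsion` with `htors`), then the reindex (B-p19)
  have hκN : ∀ x ∈ (A₀.baseChange L₁).torsionPoints L₁ (N : ℤ),
      AlgPoints.map κ.hom.hom.hom x = (A₀.baseChange L₁).conjPoints γ.toRingEquiv x := by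
    refine HomReduction.map_eq_conjPoints_of_forall_prime γ.toRingEquiv κ hN0 fun ℓ' hℓ' hℓ'N m x hx => ?_
    haveI : Fact ℓ'.Prime := ⟨hℓ'⟩
    have hℓ'v : ((ℓ' : ℕ) : 𝓞 L₁) ∉ v.asIdeal := fun h => hNv (by
      obtain ⟨m', rfl⟩ := hℓ'N
      rw [Nat.cast_mul]; exact v.asIdeal.mul_mem_right _ h)
    obtain ⟨T', Tγ', σ', hσ'a, -, -, -, -, hHγT', -, h2''⟩ := hdata ℓ' hℓ'v
    refine HomReduction.map_eq_conjPoints_of_geomTorsion_clause (A₀ := A₀.baseChange L₁) (R := R)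
      (Rγ := R.conjFrob γ hγv p 1 hcard) (p := p) (n := 1) (TA := T' none) (Tγ := Tγ') (Hγ := H0γ)
      γ.toRingEquiv (Iso.refl _) (hHγT' none) hℓ'v σ' hσ'a m
      (fun y y' hy' => ?_) κ ((Category.comp_id _).trans hκ) x hx
    exact (h2'' m y y' hy').trans (DFunLike.congr_fun (Hom.geomPointsMap_id _) _).symm
  have hF : ∀ u : K, ((N : ℕ) : K) * u ∈ (𝔞 : FractionalIdeal (𝓞 K)⁰ K) →
      (A₀.baseChange ℂ).conjPoints σ.toRingEquiv (ξ.r u) = ξ₂.r ((1 : K) * u) := by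
    intro u hu
    have hP : ξ.r u ∈ (A₀.baseChange ℂ).torsionPoints ℂ (N : ℤ) := ξ.r_nsmul_mem N u hu
    have hTinv : AlgPoints.map (baseChangeTowerIso L L₁ ℂ A₀).inv.hom.hom.hom (ξ.r u) = ξ₁.r u := by
      rw [hξ₁ u, ← AlgPoints.map_comp_apply]
      have h : (baseChangeTowerIso L L₁ ℂ A₀).hom.hom.hom.hom ≫ (baseChangeTowerIso L L₁ ℂ A₀).inv.hom.hom.hom = 𝟙 _ :=
        congr_arg (fun f : (A₀.baseChange L₁).baseChange ℂ ⟶ (A₀.baseChange L₁).baseChange ℂ => f.hom.hom.hom)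
          (baseChangeTowerIso L L₁ ℂ A₀).hom_inv_id
      rw [h, AlgPoints.map_id_apply]
    rw [AbelianVariety.conjPoints_eq_map_of_forall_torsion A₀ γ.toRingEquiv σ.toRingEquiv hσγ κ (N : ℤ) htors hκN _ hP,
      hTinv, ← hξs u, ← hξ₂ u, one_mul]
  obtain ⟨ξ', h2N, hξ'g, hξ'⟩ :=
    ξ.exists_reindex_forall_conj_eq_of_torsionCongruence_units ξ₂
      ((A₀.baseChange ℂ).conjPoints σ.toRingEquiv)
      (reflexNormFiniteIdele K Φ (traceField Φ) (IdeleAction.finitePart (traceField Φ) s))⁻¹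
      (N := N) (b := (1 : K)) (g := reflexNormFrom K Φ (traceField Φ) d₀) one_ne_zero
      (inv_ne_zero hβ0 |> fun h => by simpa using h) hF (fun u hu => hcong 𝔞 𝔞.ne_zero u hu) h𝔠
  -- §16  assembly (the junction spells `t = g(s)_𝐡⁻¹` through `reflexNormFinitePart`; B-p19's TT through
  --      `reflexNormFiniteIdele … (finitePart s)`: one rewrite)
  have ht_eq : reflexNormFinitePart K Φ (traceField Φ) s =
      reflexNormFiniteIdele K Φ (traceField Φ) (IdeleAction.finitePart (traceField Φ) s) :=
    reflexNormFinitePart_eq K Φ (traceField Φ) s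
  rw [ht_eq]
  refine ⟨ξ', Ideal.absNorm 𝔭.asIdeal, (reflexNormFrom K Φ (traceField Φ) d₀)⁻¹, ?_, hβ0, hq0, hν, h𝔞β𝔟, ht, ?_⟩
  · -- (2)_N
    intro u w hu huw
    rw [ht_eq] at huw
    exact h2N u w hu huw
  · -- §15  PAIR (B-p20 p609331 `weilPairingLevel_conjugate_reindex_eq_pow_of_model` = S5 on the model + transports)
    -- «κ_{L̄₁} = σ̃-conjugation on ℓ-power torsion» (step 11, p604665 at e := Iso.refl, from (2′) `h2'` and `hκ`)
    have hκ' : H0γ.redHom κ ≫ (Iso.refl ((R.conjFrob γ hγv p 1 hcard).reduction)).hom =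
        R.reduction.relFrobenius p 1 := (Category.comp_id _).trans hκ
    have hκσ' : ∀ (k : ℕ) (x : ((A₀.baseChange L₁).baseChange (AlgebraicClosure L₁)).torsionPoints
        (AlgebraicClosure L₁) (ℓ ^ k : ℕ)),
        AlgPoints.map (conjugateBaseChangeAlongIso γ.toRingEquiv σℓ hσℓa (A₀.baseChange L₁)).hom.hom.hom.hom
            (AlgPoints.map (Hom.baseChange (AlgebraicClosure L₁) κ).hom.hom.hom x.1) =
          ((A₀.baseChange L₁).baseChange (AlgebraicClosure L₁)).conjPoints σℓ x.1 := fun k x =>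
      HomReduction.map_conjugateBaseChangeAlongIso_baseChange_eq_conjPoints (A₀ := A₀.baseChange L₁) (R := R)
        (Rγ := R.conjFrob γ hγv p 1 hcard) (p := p) (n := 1) (TA := T0) (Tγ := Tγ) (Hγ := H0γ) γ.toRingEquiv
        (Iso.refl _) h0γ hℓv σℓ
        hσℓa k (fun y y' hy' => (h2' k y y' hy').trans (DFunLike.congr_fun (Hom.geomPointsMap_id _) _).symm) κ
        hκ' x
    -- κ = λ ≫ θ is dominant (isogeny followed by an iso) over L₁, ℂ and L̄₁ (B-p10 `isIsogeny_of_map_baseChange_r_eq`)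
    have hκisog : IsIsogeny κ := AbelianVariety.isIsogeny_comp_iso_hom
      (CMTypeUniformization.isIsogeny_of_map_baseChange_r_eq ξ₁ η (hrat' c) 𝔮 h𝔮𝔟ᵢ hlam) θ
    haveI hdomκ : IsDominant (Hom.toSchemeHom κ) := hκisog.isDominant_toSchemeHom
    haveI hdomκℂ : IsDominant (Hom.toSchemeHom (Hom.baseChange ℂ κ)) := hκisog.isDominant_toSchemeHom_baseChange ℂ
    haveI hdomκbar : IsDominant (Hom.toSchemeHom (Hom.baseChange (AlgebraicClosure L₁) κ)) :=
      hκisog.isDominant_toSchemeHom_baseChange (AlgebraicClosure L₁)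
    -- `𝔟ᵢ = β · g(s)_𝐡⁻¹𝔞` and `ξ' = ξ₂ ∘ S(β)`, `β = g(d₀)⁻¹`
    have hg0 : reflexNormFrom K Φ (traceField Φ) d₀ ≠ 0 := fun h => hβ0 (by rw [h, inv_zero])
    have h𝔠β : (𝔟ᵢ : FractionalIdeal (𝓞 K)⁰ K) = spanSingleton (𝓞 K)⁰ (reflexNormFrom K Φ (traceField Φ) d₀)⁻¹ *
        ((ideleMulIdealUnits (reflexNormFiniteIdele K Φ (traceField Φ)
          (IdeleAction.finitePart (traceField Φ) s))⁻¹ 𝔞 : (FractionalIdeal (𝓞 K)⁰ K)ˣ) : FractionalIdeal (𝓞 K)⁰ K) := by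
      change _ = _ * IdeleAction.ideleMulIdeal _ _
      rw [h𝔠, ← mul_assoc, FractionalIdeal.spanSingleton_mul_spanSingleton, inv_one, mul_one,
        inv_mul_cancel₀ hg0, FractionalIdeal.spanSingleton_one, one_mul]
    have hξ'β : ∀ w : K, ξ'.r w = ξ₂.r ((reflexNormFrom K Φ (traceField Φ) d₀)⁻¹ * w) := fun w => by
      rw [hξ' w, inv_one, mul_one]
    exact weilPairingLevel_conjugate_reindex_eq_pow_of_model A₀ ι₀ X πA hπA ξ σ.toRingEquiv πσ hπσ ℓ ξ' γ hσγ v hγv R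
      p 1 hcard H0γ κ hκ hℓv σℓ hσℓa hσℓb hκσ' ξ₁ hξ₁ ξ₂ (fun u => by rw [hξ₂ u, hξs u])
      (Ideal.absNorm 𝔭.asIdeal) hq𝔭.symm _ h𝔠β hξ'β


/-- **The landed statement (hypothesis `hS2 : shimuraTaniyamaPair`, row II-1-S2), re-proved in one line from the degree-one
edition** `exists_isLevelUniformization_of_levelField_degOne` via the bridge `shimuraTaniyamaPair_degOne_of` (E1; statement
byte-identical, consumers `levelStructure_of_facts` / b2-main / `H21_of_printedFacts` unchanged).  ORIGINAL ROLE: Shimura 1998,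
proof of Thm. 18.6 for ONE level `N` over a chosen level field, from the named facts (F-S2) `shimuraTaniyamaPair`, `FactRH′`,
(F-S5c) as hypotheses.
[cite: Shimura1998, §18.6 proof of Thm. 18.6, pp. 125–129 (esp. pp. 127–128); §13.1 Thm. 1 (i) (p. 97); §11.1 Prop. 12 (p. 83) and Prop. 14 (i) (p. 85)] -/
theorem exists_isLevelUniformization_of_levelField
    {K : Type} [Field K] [NumberField K] [IsCMField K] (Φ : CMType K) [NumberField (traceField Φ)]
    (𝔞 𝔟 : (FractionalIdeal (𝓞 K)⁰ K)ˣ)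
    {L : Type} [Field L] [NumberField L] [Algebra L ℂ] (A₀ : AbelianVariety L) (ι₀ : 𝓞 K →+* End A₀)
    (hA₀ : IsCMTypeRealisationOver Φ A₀ ι₀)
    (X : CartierDivisor A₀.X.left)
    (πA : (A₀.baseChange ℂ).X.left ⟶ A₀.X.left) (hπA : πA = pullback.fst A₀.X.hom (bcSpec L ℂ)) [IsDominant πA]
    (ξ : CMTypeUniformization Φ 𝔞 (A₀.baseChange ℂ) ((endBaseChange ℂ A₀).comp ι₀))
    (σ : ℂ ≃ₐ[traceField Φ] ℂ) (s : ideleGroup (traceField Φ)) (hs : IsArtinLift (traceField Φ) s σ)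
    (h𝔟 : 𝔟 = ideleMulIdealUnits (reflexNormFinitePart K Φ (traceField Φ) s)⁻¹ 𝔞)
    (πσ : ((A₀.baseChange ℂ).conjugate σ.toRingEquiv).X.left ⟶ (A₀.baseChange ℂ).X.left)
    (hπσ : πσ = baseChangeHomFst σ.toRingEquiv.toRingHom (A₀.baseChange ℂ).X) [IsDominant πσ]
    (ℓ : ℕ) [Fact ℓ.Prime]
    [hdomA : ∀ k : ℕ, IsDominant (Hom.toSchemeHom (((ℓ ^ k : ℕ) : ℤ) • 𝟙 (A₀.baseChange ℂ)))]
    [hdomσ : ∀ k : ℕ,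
      IsDominant (Hom.toSchemeHom (((ℓ ^ k : ℕ) : ℤ) • 𝟙 ((A₀.baseChange ℂ).conjugate σ.toRingEquiv)))]
    (N : ℕ) (hN : 0 < N) (hℓN : ℓ ∣ N)
    -- level field `L₁ ⊇ L · K* · C_N`, Galois over `K*`, `σ(L₁) = L₁` with `σ|_{L₁} = γ`
    {L₁ : Type} [Field L₁] [NumberField L₁] [Algebra L L₁] [Algebra L₁ ℂ] [IsScalarTower L L₁ ℂ]
    [Algebra (traceField Φ) L₁] [IsScalarTower (traceField Φ) L₁ ℂ] [IsGalois (traceField Φ) L₁]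
    (γ : L₁ ≃ₐ[traceField Φ] L₁) (hσγ : ∀ x : L₁, σ (algebraMap L₁ ℂ x) = algebraMap L₁ ℂ (γ x))
    (j : rayClassField (traceField Φ) (Ideal.span {((N : ℕ) : 𝓞 (traceField Φ))}) →ₐ[traceField Φ] L₁)
    -- class representatives over `L₁` (W(ii) + G0 tower)
    (Arep : ClassGroup (𝓞 K) → AbelianVariety L₁) (ιrep : ∀ c, 𝓞 K →+* End (Arep c))
    (𝔞rep : ClassGroup (𝓞 K) → (FractionalIdeal (𝓞 K)⁰ K)ˣ) (h𝔞rep : ∀ c, ClassGroup.mk K (𝔞rep c) = c)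
    (ηrep : ∀ c, CMTypeUniformization Φ (𝔞rep c) ((Arep c).baseChange ℂ) ((endBaseChange ℂ (Arep c)).comp (ιrep c)))
    -- rationality over `L₁`: `N`-torsion of `A₀ ⊗ ℂ` (G2) and homomorphisms (G1)
    (htors : ∀ Q ∈ (A₀.baseChange ℂ).torsionPoints ℂ (N : ℤ),
      ∃ x ∈ (A₀.baseChange L₁).torsionPoints L₁ (N : ℤ),
        AlgPoints.map (baseChangeTowerIso L L₁ ℂ A₀).hom.hom.hom.hom
          ((A₀.baseChange L₁).pointsMulEquiv ℂ (AlgPoints.extendScalars (A₀.baseChange L₁).X L₁ ℂ x)) = Q)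
    (hrat : ∀ c, Function.Surjective (Hom.baseChange ℂ :
      (A₀.baseChange L₁ ⟶ Arep c) → ((A₀.baseChange L₁).baseChange ℂ ⟶ (Arep c).baseChange ℂ)))
    (hrat' : ∀ c, Function.Surjective (Hom.baseChange ℂ :
      (Arep c ⟶ A₀.baseChange L₁) → ((Arep c).baseChange ℂ ⟶ (A₀.baseChange L₁).baseChange ℂ)))
    (hratγ : ∀ c, Function.Surjective (Hom.baseChange ℂ :
      (Arep c ⟶ (A₀.baseChange L₁).conjugate γ.toRingEquiv) →
        ((Arep c).baseChange ℂ ⟶ ((A₀.baseChange L₁).conjugate γ.toRingEquiv).baseChange ℂ)))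
    (hratγ' : ∀ c, Function.Surjective (Hom.baseChange ℂ :
      ((A₀.baseChange L₁).conjugate γ.toRingEquiv ⟶ Arep c) →
        (((A₀.baseChange L₁).conjugate γ.toRingEquiv).baseChange ℂ ⟶ (Arep c).baseChange ℂ)))
    -- the named facts
    (hS2 : shimuraTaniyamaPair)
    (hRH : ∀ {k : Type} [Field k] [NumberField k] {ι : Type} [Finite ι] (A : ι → AbelianVariety k),
      ∃ S : Set (HeightOneSpectrum (𝓞 k)), S.Finite ∧ ∀ v ∉ S, ∃ R : ∀ i, (A i).GoodReductionAt v,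
        (∀ i j, Nonempty (GoodReductionAt.HomReduction (R i) (R j))) ∧
        ∀ {F₀ : Type} [Field F₀] [NumberField F₀] [Algebra F₀ k] (a : ι) (γ : k ≃ₐ[F₀] k)
          (hγ : IsArithFrobAt (𝓞 F₀) γ v.asIdeal) (p n : ℕ) [ExpChar v.asIdeal.ResidueField p]
          (hq : Nat.card (𝓞 F₀ ⧸ v.asIdeal.under (𝓞 F₀)) = p ^ n),
          (∀ i, Nonempty (GoodReductionAt.HomReduction (R i) ((R a).conjFrob γ hγ p n hq))) ∧
          (∀ i, Nonempty (GoodReductionAt.HomReduction ((R a).conjFrob γ hγ p n hq) (R i))))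
    (hS5c : ∀ {F₀ k : Type} [Field F₀] [NumberField F₀] [Field k] [NumberField k] [Algebra F₀ k]
      {v : HeightOneSpectrum (𝓞 k)} {ι : Type} {A : ι → AbelianVariety k}
      (R : ∀ i, (A i).GoodReductionAt v) (H : ∀ i j, GoodReductionAt.HomReduction (R i) (R j)) (a : ι)
      (γ : k ≃ₐ[F₀] k) (hγ : IsArithFrobAt (𝓞 F₀) γ v.asIdeal) (p n : ℕ) [ExpChar v.asIdeal.ResidueField p]
      (hq : Nat.card (𝓞 F₀ ⧸ v.asIdeal.under (𝓞 F₀)) = p ^ n)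
      (Hγ : ∀ i, GoodReductionAt.HomReduction (R i) ((R a).conjFrob γ hγ p n hq))
      (Hγ' : ∀ i, GoodReductionAt.HomReduction ((R a).conjFrob γ hγ p n hq) (R i)) (ℓ : ℕ) [Fact ℓ.Prime],
      GoodReductionAt.HomReduction.exists_isTateCompatible_family_conjFrob R H a γ hγ p n hq Hγ Hγ' ℓ) :
    ∃ (ξ' : CMTypeUniformization Φ 𝔟 ((A₀.baseChange ℂ).conjugate σ.toRingEquiv)
        (((A₀.baseChange ℂ).endConjugate σ.toRingEquiv).comp ((endBaseChange ℂ A₀).comp ι₀))) (q : ℕ) (β : K),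
      IsLevelUniformization Φ 𝔞 𝔟 A₀ ι₀ X πA ξ σ s πσ ℓ N ξ' q β
        ((FractionalIdeal.absNorm (toFractionalIdeal (𝓞 (traceField Φ)) (traceField Φ)
          (IdeleAction.finitePart (traceField Φ) s)) : ℚ) : K) :=
  exists_isLevelUniformization_of_levelField_degOne Φ 𝔞 𝔟 A₀ ι₀ hA₀ X πA hπA ξ σ s hs h𝔟 πσ hπσ ℓ N hN hℓN γ hσγ j
    Arep ιrep 𝔞rep h𝔞rep ηrep htors hrat hrat' hratγ hratγ' (shimuraTaniyamaPair_degOne_of hS2) hRH hS5c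

end Literature.NumberTheory.ComplexMultiplication

end
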